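import Mathlib.Topology.UniformSpace.UniformApproximation
import Mathlib.Topology.MetricSpace.Cauchy
import Mathlib.Topology.Order.ProjIcc
import Literature.Topology.PlaneTopology.OsgoodArcCells
import HarnessLib

/-!
# Osgood arcs III: the limit curve of a cell, its self-similarity and injectivity

Topic: Topology / PlaneTopology. For every cell `Q` of the scheme of `OsgoodArcCells.lean` we
construct the curve `OsgoodArc.lim Q : ℝ → ℂ` of the Osgood arc inside `Q` (W. F. Osgood, *A Jordan
curve of positive area*, Trans. AMS 4 (1903) 107–112, fat-dust variant):

* `approx n Q` — the depth-`n` approximant: depth `0` is the diagonal segment from the entry to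
  the exit corner, depth `n + 1` glues (`OsgoodArc.glue`) the depth-`n` approximants of the two
  children with the straight bridge;
* the **uniform Cauchy estimate** `dist_approx_le` (two approximants of depths `≥ n` differ by at
  most `diam (k + n)`, because they agree on all bridges of depth `< n` and both send each depth-`n`
  time slot into the corresponding depth-`n` cell), the pointwise limit `lim Q` (extended
  constantly outside `[0, 1]`), its continuity (`continuous_lim`, uniform limit of continuous
  maps), the **self-similarity** `lim_eq_glue`, and
* **injectivity** on `[0, 1]` (`injOn_lim`): two parameters with the same image lie in a common
  ternary slot of every depth (`abs_sub_le_of_lim_eq`, by the separation lemma `glue_sep`).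

All folklore; everything proved. Mathlib anchors: `cauchySeq_tendsto_of_complete`,
`TendstoUniformlyOn.continuousOn`, `Set.IccExtend`.
-/

noncomputable section

open Set Filter _root_.Topology

namespace Literature.Topology.PlaneTopology

namespace OsgoodArc

/-! ### Approximants -/

/-- The depth-`n` approximant of the curve of a cell: depth `0` is the diagonal, depth `n + 1`
glues the depth-`n` approximants of the two children with the straight bridge. [folklore] -/
def approx : ℕ → Cell → ℝ → ℂ
  | 0, Q => seg Q.entry Q.exit
  | n + 1, Q => glue (approx n Q.fst) (approx n Q.snd) Q.fst.exit Q.snd.entry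

/-- The recursion step of `approx`. [folklore] -/
theorem approx_succ (n : ℕ) (Q : Cell) :
    approx (n + 1) Q = glue (approx n Q.fst) (approx n Q.snd) Q.fst.exit Q.snd.entry := rfl

/-- Approximants start at the entry corner. [folklore] -/
@[simp] theorem approx_zero_left : ∀ (n : ℕ) (Q : Cell), approx n Q 0 = Q.entry
  | 0, Q => by simp [approx]
  | n + 1, Q => by rw [approx_succ, glue_zero, approx_zero_left n Q.fst, Cell.fst_entry]

/-- Approximants end at the exit corner. [folklore] -/
@[simp] theorem approx_one : ∀ (n : ℕ) (Q : Cell), approx n Q 1 = Q.exit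
  | 0, Q => by simp [approx]
  | n + 1, Q => by rw [approx_succ, glue_one, approx_one n Q.snd, Cell.snd_exit]

/-- Approximants are continuous. [folklore] -/
theorem continuous_approx : ∀ (n : ℕ) (Q : Cell), Continuous (approx n Q)
  | 0, Q => continuous_seg Q.entry Q.exit
  | n + 1, Q => continuous_glue (continuous_approx n Q.fst) (continuous_approx n Q.snd)
      (approx_one n _) (approx_zero_left n _)

/-- Approximants stay in the cell on `[0, 1]`. [folklore] -/
theorem approx_mem_rect : ∀ (n : ℕ) (Q : Cell) {t : ℝ}, t ∈ Icc (0 : ℝ) 1 → approx n Q t ∈ Q.rect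
  | 0, Q, _, ht => seg_mem_box Q.entry_mem_rect Q.exit_mem_rect ht
  | n + 1, Q, _, ht => glue_mem
      (fun _ hs => Q.fst_rect_subset (approx_mem_rect n Q.fst hs))
      (fun _ hs => Q.snd_rect_subset (approx_mem_rect n Q.snd hs))
      (fun _ hs => Q.bridge_mem_rect hs) ht

/-- **Uniform Cauchy estimate**: approximants of depths `n ≤ n'` differ by at most the diameter
bound of the depth-`n` cells. [folklore] -/
theorem dist_approx_le : ∀ (n : ℕ) (Q : Cell) (n' : ℕ), n ≤ n' → ∀ t ∈ Icc (0 : ℝ) 1,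
    dist (approx n Q t) (approx n' Q t) ≤ diam (Q.k + n)
  | 0, Q, n', _, _, ht => Q.dist_le_diam (approx_mem_rect 0 Q ht) (approx_mem_rect n' Q ht)
  | n + 1, Q, n', hn', t, ht => by
    obtain ⟨m, rfl⟩ : ∃ m, n' = m + 1 := ⟨n' - 1, by omega⟩
    rw [approx_succ, approx_succ]
    have h := dist_glue_glue_le (p := Q.fst.exit) (q := Q.snd.entry) (diam_pos (Q.k + 1 + n)).le
      (dist_approx_le n Q.fst m (by omega)) (dist_approx_le n Q.snd m (by omega)) ht
    rwa [show Q.k + 1 + n = Q.k + (n + 1) by ring] at h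

/-- At each time of `[0, 1]` the approximants form a Cauchy sequence. [folklore] -/
theorem cauchySeq_approx (Q : Cell) {t : ℝ} (ht : t ∈ Icc (0 : ℝ) 1) :
    CauchySeq fun n => approx n Q t := by
  rw [Metric.cauchySeq_iff']
  intro ε hε
  obtain ⟨N, hN⟩ := diam_eventually_lt hε
  refine ⟨N, fun n hn => ?_⟩
  rw [dist_comm]
  exact (dist_approx_le N Q n hn t ht).trans_lt (hN _ (by omega))

/-! ### The limit curve -/

/-- The curve of a cell: the (uniform) limit of the approximants on `[0, 1]`, extended
constantly outside `[0, 1]`. [folklore] -/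
def lim (Q : Cell) (t : ℝ) : ℂ := limUnder atTop fun n => approx n Q (projIcc 0 1 zero_le_one t)

/-- The curve only depends on the clamped parameter. [folklore] -/
theorem lim_projIcc (Q : Cell) (t : ℝ) : lim Q (projIcc 0 1 zero_le_one t) = lim Q t := by
  simp only [lim, projIcc_val]

/-- On `[0, 1]` the approximants converge to the curve. [folklore] -/
theorem tendsto_approx_lim (Q : Cell) {t : ℝ} (ht : t ∈ Icc (0 : ℝ) 1) :
    Tendsto (fun n => approx n Q t) atTop (𝓝 (lim Q t)) := by
  obtain ⟨x, hx⟩ := cauchySeq_tendsto_of_complete (cauchySeq_approx Q ht)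
  have : lim Q t = x := by
    simp only [lim, projIcc_of_mem _ ht]
    exact hx.limUnder_eq
  rwa [this]

/-- Rate of convergence: `dist (approx n Q t) (lim Q t) ≤ diam (k + n)`. [folklore] -/
theorem dist_approx_lim_le (n : ℕ) (Q : Cell) {t : ℝ} (ht : t ∈ Icc (0 : ℝ) 1) :
    dist (approx n Q t) (lim Q t) ≤ diam (Q.k + n) :=
  le_of_tendsto (tendsto_const_nhds.dist (tendsto_approx_lim Q ht))
    (eventually_atTop.2 ⟨n, fun n' hn' => dist_approx_le n Q n' hn' t ht⟩)

/-- The convergence is uniform on `[0, 1]`. [folklore] -/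
theorem tendstoUniformlyOn_approx (Q : Cell) :
    TendstoUniformlyOn (fun n => approx n Q) (lim Q) atTop (Icc 0 1) := by
  rw [Metric.tendstoUniformlyOn_iff]
  intro ε hε
  obtain ⟨N, hN⟩ := diam_eventually_lt hε
  refine eventually_atTop.2 ⟨N, fun n hn t ht => ?_⟩
  rw [dist_comm]
  exact (dist_approx_lim_le n Q ht).trans_lt (hN _ (by omega))

/-- The curve is continuous on `[0, 1]`. [folklore] -/
theorem continuousOn_lim (Q : Cell) : ContinuousOn (lim Q) (Icc 0 1) :=
  (tendstoUniformlyOn_approx Q).continuousOn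
    (Eventually.of_forall fun n => (continuous_approx n Q).continuousOn).frequently

/-- **The curve of a cell is continuous** (on all of `ℝ`, being constant outside `[0, 1]`).
[folklore] -/
theorem continuous_lim (Q : Cell) : Continuous (lim Q) := by
  have h : lim Q = IccExtend zero_le_one (fun x : Icc (0 : ℝ) 1 => lim Q x) := by
    ext t
    rw [IccExtend, Function.comp_apply, lim_projIcc]
  rw [h]
  exact (continuousOn_iff_continuous_restrict.1 (continuousOn_lim Q)).Icc_extend'

/-- The curve starts at the entry corner. [folklore] -/
@[simp] theorem lim_zero (Q : Cell) : lim Q 0 = Q.entry :=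
  tendsto_nhds_unique (tendsto_approx_lim Q ⟨le_rfl, zero_le_one⟩) (by simp)

/-- The curve ends at the exit corner. [folklore] -/
@[simp] theorem lim_one (Q : Cell) : lim Q 1 = Q.exit :=
  tendsto_nhds_unique (tendsto_approx_lim Q ⟨zero_le_one, le_rfl⟩) (by simp)

/-- The curve of a cell stays in the cell on `[0, 1]`. [folklore] -/
theorem lim_mem_rect (Q : Cell) {t : ℝ} (ht : t ∈ Icc (0 : ℝ) 1) : lim Q t ∈ Q.rect :=
  Q.isClosed_rect.mem_of_tendsto (tendsto_approx_lim Q ht)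
    (Eventually.of_forall fun n => approx_mem_rect n Q ht)

/-- **Self-similarity of the limit**: the curve of a cell is the gluing of the curves of its two
children with the bridge. [folklore] -/
theorem lim_eq_glue (Q : Cell) {t : ℝ} (ht : t ∈ Icc (0 : ℝ) 1) :
    lim Q t = glue (lim Q.fst) (lim Q.snd) Q.fst.exit Q.snd.entry t := by
  have h1 : Tendsto (fun n => approx (n + 1) Q t) atTop (𝓝 (lim Q t)) :=
    (tendsto_approx_lim Q ht).comp (tendsto_add_atTop_nat 1)
  simp only [approx_succ] at h1
  obtain ⟨ht0, ht1⟩ := ht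
  rcases trichotomy_thirds t with h | h | h
  · rw [glue_of_le_third _ _ _ _ h]
    simp only [glue_of_le_third _ _ _ _ h] at h1
    exact tendsto_nhds_unique h1 (tendsto_approx_lim Q.fst ⟨by linarith, by linarith⟩)
  · rw [glue_of_mem_mid _ _ _ _ h.1 h.2.le]
    simp only [glue_of_mem_mid _ _ _ _ h.1 h.2.le] at h1
    exact tendsto_nhds_unique h1 tendsto_const_nhds
  · rw [glue_of_ge _ _ (lim_zero Q.snd) h]
    simp only [glue_of_ge _ _ (approx_zero_left _ Q.snd) h] at h1
    exact tendsto_nhds_unique h1 (tendsto_approx_lim Q.snd ⟨by linarith, by linarith⟩)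

/-- The first third of the curve of a cell is the curve of its first child. [folklore] -/
theorem lim_div_three (Q : Cell) {t : ℝ} (ht : t ∈ Icc (0 : ℝ) 1) :
    lim Q (t / 3) = lim Q.fst t := by
  rw [lim_eq_glue Q ⟨by linarith [ht.1], by linarith [ht.2]⟩, glue_div_three _ _ _ _ ht]

/-- The last third of the curve of a cell is the curve of its second child. [folklore] -/
theorem lim_add_two_div_three (Q : Cell) {t : ℝ} (ht : t ∈ Icc (0 : ℝ) 1) :
    lim Q ((t + 2) / 3) = lim Q.snd t := by
  rw [lim_eq_glue Q ⟨by linarith [ht.1], by linarith [ht.2]⟩,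
    glue_add_two_div_three _ _ (lim_zero Q.snd) ht]

/-! ### Injectivity -/

/-- Points of `[0, 1]` with the same image under the curve of a cell lie in a common ternary
interval of every depth. [folklore] -/
theorem abs_sub_le_of_lim_eq : ∀ (n : ℕ) (Q : Cell), ∀ s ∈ Icc (0 : ℝ) 1, ∀ t ∈ Icc (0 : ℝ) 1,
    lim Q s = lim Q t → |s - t| ≤ (1 / 3) ^ n
  | 0, Q, s, hs, t, ht, _ => by
    rw [pow_zero, abs_sub_le_iff]; constructor <;> linarith [hs.1, hs.2, ht.1, ht.2]
  | n + 1, Q, s, hs, t, ht, hst => by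
    rw [lim_eq_glue Q hs, lim_eq_glue Q ht] at hst
    have h := glue_sep (by positivity) (fun _ hu => lim_mem_rect Q.fst hu)
      (fun _ hu => lim_mem_rect Q.snd hu) Q.disjoint_rect Q.fst_exit_ne_snd_entry
      (fun _ hu => Q.bridge_avoids hu) (lim_zero Q.snd) (abs_sub_le_of_lim_eq n Q.fst)
      (abs_sub_le_of_lim_eq n Q.snd) hs ht hst
    rwa [pow_succ, ← div_eq_mul_one_div]

/-- **The curve of a cell is injective on `[0, 1]`.** [folklore] -/
theorem injOn_lim (Q : Cell) : InjOn (lim Q) (Icc 0 1) := by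
  intro s hs t ht hst
  by_contra hne
  have hpos : 0 < |s - t| := abs_pos.2 (sub_ne_zero.2 hne)
  obtain ⟨n, hn⟩ := exists_pow_lt_of_lt_one hpos (show (1 / 3 : ℝ) < 1 by norm_num)
  exact absurd hn (not_lt.2 (abs_sub_le_of_lim_eq n Q s hs t ht hst))

end OsgoodArc

end Literature.Topology.PlaneTopology
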